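import Mathlib
import HarnessLib

/-!
# Negative-root counts are additive over the cells of a block-diagonal matrix (stub S4)

Linear algebra consumed by `WindowExtinction_of` (line `Sketch`, crux idea
`wall-conditioned-cell-spread`).  After conditioning on the walls, the cell block of the Hermitian
Wilson operator is block-diagonal over the cells, `blockDiagonal A` with `A : ι → Matrix m m ℂ`, and
the line needs the negative-root count `n₋(M) = #{roots z of charpoly M with re z < 0}` (with
multiplicity) to be additive over the cells.

Proof.  The `charmatrix` of a block-diagonal matrix is block-diagonal, so `Matrix.det_blockDiagonal`
gives `charpoly (blockDiagonal A) = ∏ i, charpoly (A i)`; each factor is monic hence nonzero, so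
`Polynomial.roots_prod` turns the roots of the product into the `bind` (sum) of the root multisets,
and `Multiset.countP` is additive (`Multiset.countP_add`, induction over the index `Finset`).
The statement is proved for an arbitrary decidable predicate on the roots and then specialised to
`re z < 0`.
-/

namespace Summit.QuantumFields.QCD.Cruxes.WindowExtinction.WallConditionedCellSpread

open Matrix
open scoped BigOperators

-- adapted from `Summit.QuantumFields.QCD.Cruxes.TipPricing.ModularTemplate.charpoly_blockDiagonal_eq_prod`
-- (tree file `SpectralDefectExtinctionTipPricingInertiaGluing.lean`, not importable here).
/-- The `charmatrix` of a block-diagonal matrix is the block-diagonal matrix of the `charmatrix`es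
of the blocks. [folklore] -/
theorem charmatrix_blockDiagonal_cells {ι m : Type*} [Fintype ι] [DecidableEq ι] [Fintype m]
    [DecidableEq m] (A : ι → Matrix m m ℂ) :
    (blockDiagonal A).charmatrix = blockDiagonal fun i => (A i).charmatrix := by
  ext ⟨a, i⟩ ⟨b, j⟩
  simp only [charmatrix_apply, blockDiagonal_apply, diagonal_apply, Prod.mk.injEq]
  by_cases hij : i = j
  · subst hij
    simp
  · simp [hij]

/-- The characteristic polynomial of a block-diagonal matrix is the product of the characteristic
polynomials of the blocks (`Matrix.det_blockDiagonal` applied to the `charmatrix`). [folklore] -/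
theorem charpoly_blockDiagonal_cells {ι m : Type*} [Fintype ι] [DecidableEq ι] [Fintype m]
    [DecidableEq m] (A : ι → Matrix m m ℂ) :
    (blockDiagonal A).charpoly = ∏ i, (A i).charpoly := by
  rw [Matrix.charpoly, charmatrix_blockDiagonal_cells, det_blockDiagonal]
  rfl

/-- `Multiset.countP` is additive over a finite `bind` of multisets. [folklore] -/
theorem countP_finset_bind {ι α : Type*} (s : Finset ι) (f : ι → Multiset α) (p : α → Prop)
    [DecidablePred p] :
    (s.val.bind f).countP p = ∑ i ∈ s, (f i).countP p := by
  classical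
  induction s using Finset.induction_on with
  | empty => simp
  | insert a s ha ih =>
    rw [Finset.insert_val_of_notMem ha, Multiset.cons_bind, Multiset.countP_add, ih,
      Finset.sum_insert ha]

/-- Root counts (for any decidable predicate on the roots, with multiplicity) of a block-diagonal
matrix are additive over the blocks. [folklore] -/
theorem countP_roots_charpoly_blockDiagonal_cells {ι m : Type*} [Fintype ι] [DecidableEq ι]
    [Fintype m] [DecidableEq m] (A : ι → Matrix m m ℂ) (p : ℂ → Prop) [DecidablePred p] :
    (blockDiagonal A).charpoly.roots.countP p = ∑ i, (A i).charpoly.roots.countP p := by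
  rw [charpoly_blockDiagonal_cells, Polynomial.roots_prod _ _
    (Finset.prod_ne_zero_iff.2 fun i _ => (Matrix.charpoly_monic (A i)).ne_zero)]
  exact countP_finset_bind Finset.univ _ p

/-- **S4 — negative-root counts are additive over cells.**  For a block-diagonal matrix
`blockDiagonal A`, `A : ι → Matrix m m ℂ`, the number of characteristic roots with negative real
part (counted with multiplicity) is the sum over the blocks of the same count:
`charpoly (blockDiagonal A) = ∏ i, charpoly (A i)`, roots of a product of monic polynomials are the
sum of the root multisets, and `countP` is additive. -/
theorem stub_negCountBlockDiagonal :
    ∀ {ι m : Type*} [Fintype ι] [DecidableEq ι] [Fintype m] [DecidableEq m] (A : ι → Matrix m m ℂ),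
      (Matrix.blockDiagonal A).charpoly.roots.countP (fun z => z.re < 0) =
        ∑ i, (A i).charpoly.roots.countP (fun z => z.re < 0) := by
  intro ι m _ _ _ _ A
  exact countP_roots_charpoly_blockDiagonal_cells A _

end Summit.QuantumFields.QCD.Cruxes.WindowExtinction.WallConditionedCellSpread
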